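import Summits.CriticalPhenomena.SAWScalingLimit.Theorems.FKGToTraversalBound.Negative.DeepEndpointGap
import Summits.CriticalPhenomena.SAWScalingLimit.Theorems.SAWLeftRightFKGLeftRightFKGStubLoopWindVanish
import Summits.CriticalPhenomena.SAWScalingLimit.Theorems.SAWLeftRightFKGLeftRightFKGStubMeshReduction
import Literature.Probability.LatticeModels.DirichletGreenFunction
import Literature.Probability.LatticeModels.LatticeHarnackOneScale
import HarnessLib

/-!
# Stub `stub_rwCollarOfKilled` (reshape r6) of line `excursion-domination`, crux `FKGToTraversalBound`
(stmt-CriticalPhenomena-1878): the registered collar bound from the killed-walk kernel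

The r5 stub `stub_rwCollarBound` (the random-walk collar bound for r2 lattice domains
`Λ = meshDomain (dom C δ) δ`) follows from the killed-walk collar bound on HOLE-FREE lattice domains
(registered separately as `stub_killedWalkCollarBound`, the Kemppainen–Smirnov 2017 Prop. 4.11 /
Thm. 4.12 kernel) by two facts proved here:

* §1 `holeFree_meshDomain_dom` — `meshDomain (dom C δ) δ` is hole-free (`HoleFree`): every site off it
  is joined off it to sites of arbitrarily large ordinate.  Walk north: the index of `C` is constant
  along a unit lattice segment missing the trace of `C` (`wind_sub_eq_of_mem_connectedComponentIn`; a
  lattice point of the trace is a vertex of `C`, `mem_support_of_toComplex_mem_range`), two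
  lattice-adjacent sites of `dom C 1` off the trace are adjacent in the mesh graph
  (`meshGraph_adj_of_adj`, so a dropped component of the mesh-vertex graph never touches a kept one,
  `mem_meshDomain_of_reachable`), and from a vertex of `C` one escapes east of the trace and then north
  (`Negative.noFloatingHoles`, `Negative.notMem_dom_of_forall_lt`); the mesh is reduced to `1` by
  `CornerLoc.meshDomain_dom`.
* §2 `dirichletGreen_pos_of_walk` — `G_Λ(a,b) > 0` when `a` is joined to `b` inside `Λ`
  (`G_Λ(b,b) ≥ 1/4` and `4 G_Λ(b,x) ≥ ∑_{w ∼ x} G_Λ(b,w)` along the path).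

§3 assembles `stub_rwCollarOfKilled` (the first-entrance decomposition hypothesis is not needed for this
direction).  Classical material, no named fact. [folklore]
-/

noncomputable section

open Set SimpleGraph
open Literature.Probability.LatticeModels
open Literature.Topology.PlaneTopology
open Summit.CriticalPhenomena.SAWScalingLimit.Theorems.FKGToTraversalBound.Negative (dom)

namespace Summit.CriticalPhenomena.SAWScalingLimit.Theorems.FKGToTraversalBound.ExcursionDomination

/-! ## §1  Hole-freeness of r2 lattice domains -/

section HoleFree

variable {c : Site 2} (C : (zdGraph 2).Walk c c)

/-- The extended closed polyline of `C` at mesh `1` is continuous. [folklore] -/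
theorem continuous_iccExtend_toCurve :
    Continuous fun t : ℝ => Set.IccExtend zero_le_one (C.toCurve (meshPoint 1)) t :=
  (C.toCurve (meshPoint 1)).continuous.Icc_extend'

/-- The extended polyline of the closed walk `C` is a loop. [folklore] -/
theorem iccExtend_toCurve_zero_eq_one :
    Set.IccExtend zero_le_one (C.toCurve (meshPoint 1)) 0 =
      Set.IccExtend zero_le_one (C.toCurve (meshPoint 1)) 1 := by
  have h01 : (C.toCurve (meshPoint 1)) 0 = (C.toCurve (meshPoint 1)) 1 := by
    rw [SimpleGraph.Walk.toCurve_apply_zero, SimpleGraph.Walk.toCurve_apply_one]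
  rw [Set.IccExtend_left, Set.IccExtend_right]
  exact h01

/-- The extended polyline maps `[0, 1]` into the trace. [folklore] -/
theorem mapsTo_iccExtend_toCurve :
    MapsTo (fun t : ℝ => Set.IccExtend zero_le_one (C.toCurve (meshPoint 1)) t) (Icc 0 1)
      (Set.range (C.toCurve (meshPoint 1))) := fun _ _ => ⟨_, rfl⟩

/-- The trace of `C` is closed. [folklore] -/
theorem isClosed_range_toCurve : IsClosed (Set.range (C.toCurve (meshPoint 1))) :=
  (isCompact_range (C.toCurve (meshPoint 1)).continuous).isClosed

/-- `dom C 1` unfolded. [folklore] -/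
theorem mem_dom_one_iff (z : ℂ) : z ∈ dom C 1 ↔
    wind (fun t : ℝ => Set.IccExtend zero_le_one (C.toCurve (meshPoint 1)) t - z) ≠ 0 := Iff.rfl

/-- Two sites with the same complex point are equal. [folklore] -/
theorem eq_of_toComplex_eq {x y : Site 2} (h : Site.toComplex x = Site.toComplex y) : x = y := by
  have h0 : ((x 0 : ℤ) : ℝ) = y 0 := by
    have := congrArg Complex.re h; simpa [Site.toComplex] using this
  have h1 : ((x 1 : ℤ) : ℝ) = y 1 := by
    have := congrArg Complex.im h; simpa [Site.toComplex] using this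
  exact Site.eq_iff_two.2 ⟨by exact_mod_cast h0, by exact_mod_cast h1⟩

/-- **A lattice point of the trace of `C` is a vertex of `C`.** [folklore] -/
theorem mem_support_of_toComplex_mem_range {x : Site 2}
    (hx : Site.toComplex x ∈ Set.range (C.toCurve (meshPoint 1))) : x ∈ C.support := by
  have key : Set.range (C.toCurve (meshPoint 1)) ⊆
      {z | ∀ y : Site 2, z = Site.toComplex y → y ∈ C.support} := by
    refine SimpleGraph.Walk.range_toCurve_subset C ?_ ?_
    · intro y hy
      rw [LeftRightFKG.Negative.meshPoint_one] at hy
      rw [← eq_of_toComplex_eq hy]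
      exact C.start_mem_support
    · intro d hd z hz y hy
      subst hy
      rw [LeftRightFKG.Negative.meshPoint_one, LeftRightFKG.Negative.meshPoint_one] at hz
      rcases LeftRightFKG.CornerLoc.pt_eq_of_mem_segment d.adj hz with h | h
      · rw [eq_of_toComplex_eq h]; exact C.dart_fst_mem_support_of_mem_darts hd
      · rw [eq_of_toComplex_eq h]; exact C.dart_snd_mem_support_of_mem_darts hd
  exact key hx x rfl

/-- A unit lattice segment whose endpoints are not vertices of `C` misses the trace of `C`.
[folklore] -/
theorem disjoint_segment_range_toCurve {x y : Site 2} (hxy : (zdGraph 2).Adj x y)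
    (hx : x ∉ C.support) (hy : y ∉ C.support) :
    Disjoint (segment ℝ (Site.toComplex x) (Site.toComplex y)) (Set.range (C.toCurve (meshPoint 1))) := by
  rw [Set.disjoint_iff_inter_eq_empty, Set.eq_empty_iff_forall_notMem]
  rintro z ⟨hz, hz'⟩
  have key : Set.range (C.toCurve (meshPoint 1)) ⊆ (segment ℝ (Site.toComplex x) (Site.toComplex y))ᶜ := by
    refine SimpleGraph.Walk.range_toCurve_subset C ?_ ?_
    · intro hc
      rw [LeftRightFKG.Negative.meshPoint_one] at hc
      rcases LeftRightFKG.CornerLoc.pt_eq_of_mem_segment hxy hc with h | h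
      · exact hx (eq_of_toComplex_eq h ▸ C.start_mem_support)
      · exact hy (eq_of_toComplex_eq h ▸ C.start_mem_support)
    · intro d hd
      rw [LeftRightFKG.Negative.meshPoint_one, LeftRightFKG.Negative.meshPoint_one]
      refine (LeftRightFKG.CornerLoc.disjoint_segment_of_not_mem hxy d.adj ?_ ?_).subset_compl_left
      · intro h
        rcases LeftRightFKG.CornerLoc.pt_eq_of_mem_segment d.adj h with h' | h'
        · exact hx (eq_of_toComplex_eq h' ▸ C.dart_fst_mem_support_of_mem_darts hd)
        · exact hx (eq_of_toComplex_eq h' ▸ C.dart_snd_mem_support_of_mem_darts hd)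
      · intro h
        rcases LeftRightFKG.CornerLoc.pt_eq_of_mem_segment d.adj h with h' | h'
        · exact hy (eq_of_toComplex_eq h' ▸ C.dart_fst_mem_support_of_mem_darts hd)
        · exact hy (eq_of_toComplex_eq h' ▸ C.dart_snd_mem_support_of_mem_darts hd)
  exact key hz' hz

/-- **The index of `C` is constant along a unit lattice segment off its trace.** [folklore] -/
theorem wind_eq_of_mem_segment {x y : Site 2} (hxy : (zdGraph 2).Adj x y)
    (hx : x ∉ C.support) (hy : y ∉ C.support) {z : ℂ}
    (hz : z ∈ segment ℝ (Site.toComplex x) (Site.toComplex y)) :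
    wind (fun t => Set.IccExtend zero_le_one (C.toCurve (meshPoint 1)) t - z) =
      wind (fun t => Set.IccExtend zero_le_one (C.toCurve (meshPoint 1)) t - Site.toComplex x) := by
  have hdisj := disjoint_segment_range_toCurve C hxy hx hy
  have hsub : segment ℝ (Site.toComplex x) (Site.toComplex y) ⊆ (Set.range (C.toCurve (meshPoint 1)))ᶜ :=
    fun w hw hw' => Set.disjoint_left.1 hdisj hw hw'
  have hzc : z ∈ connectedComponentIn (Set.range (C.toCurve (meshPoint 1)))ᶜ (Site.toComplex x) :=
    (convex_segment _ _).isPreconnected.subset_connectedComponentIn (left_mem_segment ℝ _ _) hsub hz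
  exact (wind_sub_eq_of_mem_connectedComponentIn (continuous_iccExtend_toCurve C).continuousOn
    (iccExtend_toCurve_zero_eq_one C) (isClosed_range_toCurve C) (mapsTo_iccExtend_toCurve C) hzc).symm

/-- Vertices of `C` are not in the lattice domain. [folklore] -/
theorem notMem_meshDomain_of_mem_support {x : Site 2} (hx : x ∈ C.support) :
    x ∉ meshDomain (dom C 1) 1 := fun h => by
  have h' := meshDomain_subset_meshVertices _ _ h
  rw [mem_meshVertices_iff] at h'
  exact Negative.notMem_dom_of_mem_support C 1 hx h'

/-- Lattice-adjacent sites of `dom C 1`, neither a vertex of `C`, are adjacent in the mesh graph: the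
unit segment between them lies in `dom C 1`. [folklore] -/
theorem meshGraph_adj_of_adj {x y : Site 2} (hxy : (zdGraph 2).Adj x y) (hx : x ∉ C.support)
    (hy : y ∉ C.support) (hxd : meshPoint 1 x ∈ dom C 1) : (meshGraph (dom C 1) 1).Adj x y := by
  refine meshGraph_adj_iff.2 ⟨hxy, fun z hz => subset_closure ?_⟩
  rw [LeftRightFKG.Negative.meshPoint_one, LeftRightFKG.Negative.meshPoint_one] at hz
  rw [LeftRightFKG.Negative.meshPoint_one] at hxd
  rw [mem_dom_one_iff] at hxd ⊢
  rwa [wind_eq_of_mem_segment C hxy hx hy hz]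

/-- `meshDomain` is a union of components of the mesh-vertex graph: a mesh vertex joined in the
mesh-vertex graph to a site of `meshDomain` lies in `meshDomain`. [folklore] -/
theorem mem_meshDomain_of_reachable {Ω : Set ℂ} {δ : ℝ} {x y : Site 2}
    (hxv : x ∈ meshVertices Ω δ) (hyv : y ∈ meshVertices Ω δ)
    (hr : (meshVertexGraph Ω δ).Reachable ⟨x, hxv⟩ ⟨y, hyv⟩) (hy : y ∈ meshDomain Ω δ) :
    x ∈ meshDomain Ω δ := by
  simp only [meshDomain, Set.mem_iUnion, Set.mem_image] at hy ⊢
  obtain ⟨K, hK, y', hy', hyy'⟩ := hy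
  have hy'eq : y' = ⟨y, hyv⟩ := Subtype.ext hyy'
  subst hy'eq
  refine ⟨K, hK, ⟨x, hxv⟩, ?_, rfl⟩
  rw [SimpleGraph.ConnectedComponent.mem_supp_iff] at hy' ⊢
  rw [← hy']
  exact SimpleGraph.ConnectedComponent.sound hr

/-- **One step north off the lattice domain**: if `x ∉ Λ` is not a vertex of `C` and neither is the
site `y` north of it, then `y ∉ Λ` (`Λ = meshDomain (dom C 1) 1`). [folklore] -/
theorem notMem_meshDomain_north {x y : Site 2} (hxy : (zdGraph 2).Adj x y)
    (hxΛ : x ∉ meshDomain (dom C 1) 1) (hx : x ∉ C.support) (hy : y ∉ C.support) :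
    y ∉ meshDomain (dom C 1) 1 := by
  intro hyΛ
  have hyv : y ∈ meshVertices (dom C 1) 1 := meshDomain_subset_meshVertices _ _ hyΛ
  by_cases hxd : meshPoint 1 x ∈ dom C 1
  · -- `x` is a mesh vertex adjacent to `y` in the mesh graph: same component
    have hadj : (meshGraph (dom C 1) 1).Adj x y := meshGraph_adj_of_adj C hxy hx hy hxd
    have hxv : x ∈ meshVertices (dom C 1) 1 := hxd
    have hr : (meshVertexGraph (dom C 1) 1).Reachable ⟨x, hxv⟩ ⟨y, hyv⟩ := by
      refine SimpleGraph.Adj.reachable ?_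
      simp only [SimpleGraph.comap_adj, Function.Embedding.coe_subtype]
      exact hadj
    exact hxΛ (mem_meshDomain_of_reachable hxv hyv hr hyΛ)
  · -- the index is `0` at `x`, hence at `y`
    apply hxd
    rw [mem_meshVertices_iff, LeftRightFKG.Negative.meshPoint_one, mem_dom_one_iff] at hyv
    rw [LeftRightFKG.Negative.meshPoint_one, mem_dom_one_iff]
    rwa [wind_eq_of_mem_segment C hxy hx hy (right_mem_segment ℝ _ _)] at hyv

/-- A site is adjacent to the site one step north. [folklore] -/
theorem adj_north (x : Site 2) : (zdGraph 2).Adj x (x + Pi.single 1 1 : Site 2) :=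
  (zdGraph_adj_iff _ _).2 ⟨1, Or.inl rfl⟩

/-- Climbing `k` steps north from a site east of the whole trace stays off `Λ`. [folklore] -/
theorem exists_north_chain_of_forall_lt {u : Site 2} (hu : ∀ v ∈ C.support, v 0 < u 0) :
    ∀ k : ℕ, ∃ g' : Site 2, g' 1 = u 1 + k ∧ (∀ v ∈ C.support, v 0 < g' 0) ∧
      Relation.ReflTransGen (FaceStep (meshDomain (dom C 1) 1)) u g'
  | 0 => ⟨u, by simp, hu, Relation.ReflTransGen.refl⟩
  | k + 1 => by
    obtain ⟨g, hg1, hg0, hchain⟩ := exists_north_chain_of_forall_lt hu k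
    have hg0' : ∀ v ∈ C.support, v 0 < (g + Pi.single 1 1 : Site 2) 0 := fun v hv => by
      have e : (g + Pi.single 1 1 : Site 2) 0 = g 0 := by simp
      rw [e]; exact hg0 v hv
    have hgΛ : g ∉ meshDomain (dom C 1) 1 := fun h =>
      Negative.notMem_dom_of_forall_lt C one_pos hg0 (meshDomain_subset_meshVertices _ _ h)
    have hg'Λ : (g + Pi.single 1 1 : Site 2) ∉ meshDomain (dom C 1) 1 := fun h =>
      Negative.notMem_dom_of_forall_lt C one_pos hg0' (meshDomain_subset_meshVertices _ _ h)
    have e1 : (g + Pi.single 1 1 : Site 2) 1 = g 1 + 1 := by simp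
    refine ⟨(g + Pi.single 1 1 : Site 2), by rw [e1, hg1]; push_cast; ring, hg0', ?_⟩
    exact hchain.tail ⟨adj_north g, hgΛ, hg'Λ⟩

/-- **Escape from a vertex of `C`** (`noFloatingHoles`): off `Λ`, first east of the trace, then
north. [folklore] -/
theorem exists_escape_of_mem_support {x : Site 2} (hx : x ∈ C.support) (M : ℤ) :
    ∃ g' : Site 2, M ≤ g' 1 ∧ Relation.ReflTransGen (FaceStep (meshDomain (dom C 1) 1)) x g' := by
  obtain ⟨u, p, hu, hp⟩ := Negative.noFloatingHoles C one_pos hx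
  have hpΛ : ∀ z ∈ p.support, z ∉ meshDomain (dom C 1) 1 := fun z hz h =>
    hp z hz (meshDomain_subset_meshVertices _ _ h)
  have h1 := reflTransGen_faceStep_of_walk p hpΛ
  obtain ⟨g', hg'1, -, h2⟩ := exists_north_chain_of_forall_lt C hu (M - u 1).toNat
  refine ⟨g', ?_, h1.trans h2⟩
  rw [hg'1]
  have := Int.self_le_toNat (M - u 1)
  omega

/-- The main induction: from any site off `Λ` one climbs `n` units (or more) off `Λ`. [folklore] -/
theorem exists_climb (n : ℕ) : ∀ x : Site 2, x ∉ meshDomain (dom C 1) 1 →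
    ∃ g' : Site 2, x 1 + n ≤ g' 1 ∧ Relation.ReflTransGen (FaceStep (meshDomain (dom C 1) 1)) x g' := by
  induction n with
  | zero => exact fun x _ => ⟨x, by simp, Relation.ReflTransGen.refl⟩
  | succ n ih =>
    intro x hxΛ
    by_cases hx : x ∈ C.support
    · exact exists_escape_of_mem_support C hx _
    by_cases hy : (x + Pi.single 1 1 : Site 2) ∈ C.support
    · have hyΛ : (x + Pi.single 1 1 : Site 2) ∉ meshDomain (dom C 1) 1 :=
        notMem_meshDomain_of_mem_support C hy
      obtain ⟨g', hg', hchain⟩ := exists_escape_of_mem_support C hy (x 1 + (n + 1 : ℕ))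
      exact ⟨g', hg', Relation.ReflTransGen.head ⟨adj_north x, hxΛ, hyΛ⟩ hchain⟩
    · have hyΛ : (x + Pi.single 1 1 : Site 2) ∉ meshDomain (dom C 1) 1 :=
        notMem_meshDomain_north C (adj_north x) hxΛ hx hy
      obtain ⟨g', hg', hchain⟩ := ih (x + Pi.single 1 1 : Site 2) hyΛ
      refine ⟨g', ?_, Relation.ReflTransGen.head ⟨adj_north x, hxΛ, hyΛ⟩ hchain⟩
      have e1 : (x + Pi.single 1 1 : Site 2) 1 = x 1 + 1 := by simp
      rw [e1] at hg'
      push_cast at hg' ⊢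
      omega

/-- **Hole-freeness of r2 lattice domains at mesh `1`.** [folklore] -/
theorem holeFree_meshDomain_dom_one : HoleFree (meshDomain (dom C 1) 1) := by
  intro g hg M
  obtain ⟨g', hg', hchain⟩ := exists_climb C (M - g 1).toNat g hg
  refine ⟨g', ?_, hchain⟩
  have := Int.self_le_toNat (M - g 1)
  omega

/-- **Hole-freeness of r2 lattice domains** (`HoleFree`, the lattice form of "simply connected"):
every site off `Λ = meshDomain (dom C δ) δ` is joined off `Λ` to sites of arbitrarily large ordinate —
the complement of an r2 lattice domain is connected to infinity through the trace of `C`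
(`Negative.noFloatingHoles`), including the dropped non-maximal components and the index-`0` pockets.
[folklore] -/
theorem holeFree_meshDomain_dom {δ : ℝ} (hδ : δ ≠ 0) : HoleFree (meshDomain (dom C δ) δ) := by
  have e : meshDomain (dom C δ) δ = meshDomain (dom C 1) 1 :=
    LeftRightFKG.CornerLoc.meshDomain_dom C hδ
  rw [e]
  exact holeFree_meshDomain_dom_one C

end HoleFree

/-! ## §2  Positivity of the Dirichlet Green function along a path -/

/-- **`G_Λ(a,b) > 0` when `a` is joined to `b` inside `Λ`**: `G_Λ(b,b) ≥ 1/4`, and along an edge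
`a ∼ a₁` of the path `4 G_Λ(b,a) ≥ ∑_{w ∼ a} G_Λ(b,w) ≥ G_Λ(b,a₁) > 0`
(`sum_neighborFinset_dirichletGreen`, `dirichletGreen_nonneg`, symmetry). [folklore] -/
theorem dirichletGreen_pos_of_walk {Λ : Finset (Site 2)} {a b : Site 2} (p : (zdGraph 2).Walk a b)
    (hp : ∀ x ∈ p.support, x ∈ Λ) : 0 < dirichletGreen Λ a b := by
  induction p with
  | nil =>
    rename_i u
    have hu : u ∈ Λ := hp u (by simp)
    have h := sum_neighborFinset_dirichletGreen two_pos Λ u hu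
    rw [if_pos rfl] at h
    have hnn : 0 ≤ ∑ w ∈ (zdGraph 2).neighborFinset u, dirichletGreen Λ u w :=
      Finset.sum_nonneg fun w _ => dirichletGreen_nonneg two_pos Λ u w
    rw [h] at hnn
    push_cast at hnn
    linarith
  | cons hadj q ih =>
    rename_i u v w
    have hu : u ∈ Λ := hp u (by simp)
    have hq : ∀ x ∈ q.support, x ∈ Λ := fun x hx => hp x (by simp [hx])
    have hv : 0 < dirichletGreen Λ v w := ih hq
    have h := sum_neighborFinset_dirichletGreen two_pos Λ w hu
    have hle : dirichletGreen Λ w v ≤ ∑ x ∈ (zdGraph 2).neighborFinset u, dirichletGreen Λ w x :=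
      Finset.single_le_sum (f := fun x => dirichletGreen Λ w x)
        (fun x _ => dirichletGreen_nonneg two_pos Λ w x)
        ((SimpleGraph.mem_neighborFinset _ _ _).2 hadj)
    rw [dirichletGreen_comm Λ v w] at hv
    rw [dirichletGreen_comm Λ u w]
    have hif : (0 : ℝ) ≤ if w = u then 1 else 0 := by split_ifs <;> norm_num
    rw [h] at hle
    push_cast at hle
    linarith

/-! ## §3  The registered stub: the collar bound for r2 domains from the killed-walk kernel -/

/-- **Stub `stub_rwCollarOfKilled`** (reshape r6, registered signature): the killed-walk collar bound on
hole-free lattice domains implies the random-walk collar bound `RWCollarBound` of the line for every r2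
domain — `Λ = meshDomain (dom C δ) δ` is hole-free (`holeFree_meshDomain_dom`) and `G_Λ(a,b) > 0` because
`a` is joined to `b` in `Λ ∖ V` (`dirichletGreen_pos_of_walk`); the first-entrance decomposition
hypothesis is not used. [folklore] -/
theorem stub_rwCollarOfKilled :
    (∃ (M η : ℝ), 1 < M ∧ 0 < η ∧ ∀ (δ : ℝ) (Λ : Finset (Site 2)) (a b : Site 2), 0 < δ →
        HoleFree (↑Λ : Set (Site 2)) →
        ∀ (z₀ : ℂ) (r R : ℝ) (H : Finset (Site 2)), δ ≤ r → M * r ≤ R →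
          (∃ V : Finset (Site 2), V ⊆ Λ ∧
            (∀ x ∈ V, r ≤ dist (meshPoint δ x) z₀ ∧ dist (meshPoint δ x) z₀ ≤ R) ∧
            (∃ p : (zdGraph 2).Walk a b, ∀ x ∈ p.support, x ∈ Λ ∧ x ∉ V) ∧
            (∀ y, (∃ p : (zdGraph 2).Walk a y, ∀ x ∈ p.support, x ∈ Λ ∧ x ∉ V) → y ∉ H) ∧
            (∀ x ∈ V, x ∉ H) ∧
            (∃ p : Site 2, p ∉ Λ ∧ dist (meshPoint δ p) z₀ ≤ r + δ) ∧
            ((∀ x ∈ V, ∀ y ∈ Λ, y ∉ V → (zdGraph 2).Adj x y →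
                ((∃ p : (zdGraph 2).Walk a y, ∀ x ∈ p.support, x ∈ Λ ∧ x ∉ V) →
                  dist (meshPoint δ y) z₀ < r) ∧
                ((∃ h ∈ H, (∃ p : (zdGraph 2).Walk y h, ∀ x ∈ p.support, x ∈ Λ ∧ x ∉ V)) →
                  R < dist (meshPoint δ y) z₀)) ∨
             (∀ x ∈ V, ∀ y ∈ Λ, y ∉ V → (zdGraph 2).Adj x y →
                ((∃ p : (zdGraph 2).Walk a y, ∀ x ∈ p.support, x ∈ Λ ∧ x ∉ V) →
                  R < dist (meshPoint δ y) z₀) ∧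
                ((∃ h ∈ H, (∃ p : (zdGraph 2).Walk y h, ∀ x ∈ p.support, x ∈ Λ ∧ x ∉ V)) →
                  dist (meshPoint δ y) z₀ < r)))) →
          η * dirichletGreen Λ a b ≤ dirichletGreen (Λ \ H) a b) →
    (∀ (Λ H : Finset (Site 2)) (a b : Site 2), a ∉ H →
      dirichletGreen Λ a b = dirichletGreen (Λ \ H) a b +
        ∑ z ∈ H, poissonKernel (Λ \ H) a z * dirichletGreen Λ z b) →
    ∃ (M η : ℝ), 1 < M ∧ 0 < η ∧ ∀ (δ : ℝ) (c a b a' b' : Site 2) (C : (zdGraph 2).Walk c c),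
      0 < δ → a' ∈ C.support → b' ∈ C.support → (zdGraph 2).Adj a a' → (zdGraph 2).Adj b b' →
      ∀ (hΛ : (meshDomain (dom C δ) δ).Finite) (z₀ : ℂ) (r R : ℝ) (H : Finset (Site 2)),
        δ ≤ r → M * r ≤ R →
        (∃ V : Finset (Site 2), V ⊆ hΛ.toFinset ∧
          (∀ x ∈ V, r ≤ dist (meshPoint δ x) z₀ ∧ dist (meshPoint δ x) z₀ ≤ R) ∧
          (∃ p : (zdGraph 2).Walk a b, ∀ x ∈ p.support, x ∈ hΛ.toFinset ∧ x ∉ V) ∧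
          (∀ y, (∃ p : (zdGraph 2).Walk a y, ∀ x ∈ p.support, x ∈ hΛ.toFinset ∧ x ∉ V) → y ∉ H) ∧ (∀ x ∈ V, x ∉ H) ∧
          (∃ p : Site 2, p ∉ hΛ.toFinset ∧ dist (meshPoint δ p) z₀ ≤ r + δ) ∧
          ((∀ x ∈ V, ∀ y ∈ hΛ.toFinset, y ∉ V → (zdGraph 2).Adj x y →
              ((∃ p : (zdGraph 2).Walk a y, ∀ x ∈ p.support, x ∈ hΛ.toFinset ∧ x ∉ V) → dist (meshPoint δ y) z₀ < r) ∧
              ((∃ h ∈ H, (∃ p : (zdGraph 2).Walk y h, ∀ x ∈ p.support, x ∈ hΛ.toFinset ∧ x ∉ V)) → R < dist (meshPoint δ y) z₀)) ∨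
           (∀ x ∈ V, ∀ y ∈ hΛ.toFinset, y ∉ V → (zdGraph 2).Adj x y →
              ((∃ p : (zdGraph 2).Walk a y, ∀ x ∈ p.support, x ∈ hΛ.toFinset ∧ x ∉ V) → R < dist (meshPoint δ y) z₀) ∧
              ((∃ h ∈ H, (∃ p : (zdGraph 2).Walk y h, ∀ x ∈ p.support, x ∈ hΛ.toFinset ∧ x ∉ V)) → dist (meshPoint δ y) z₀ < r)))) →
        0 < dirichletGreen hΛ.toFinset a b ∧
          η * dirichletGreen hΛ.toFinset a b ≤ dirichletGreen (hΛ.toFinset \ H) a b := by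
  intro hKS _hGreen
  obtain ⟨M, η, hM, hη, h⟩ := hKS
  refine ⟨M, η, hM, hη, ?_⟩
  intro δ c a b a' b' C hδ _ _ _ _ hΛ z₀ r R H hδr hMR hcollar
  have hhf : HoleFree (↑hΛ.toFinset : Set (Site 2)) := by
    rw [Set.Finite.coe_toFinset]
    exact holeFree_meshDomain_dom C hδ.ne'
  refine ⟨?_, h δ hΛ.toFinset a b hδ hhf z₀ r R H hδr hMR hcollar⟩
  obtain ⟨V, -, -, ⟨p, hp⟩, -⟩ := hcollar
  exact dirichletGreen_pos_of_walk p fun x hx => (hp x hx).1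

end Summit.CriticalPhenomena.SAWScalingLimit.Theorems.FKGToTraversalBound.ExcursionDomination

end
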